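import Mathlib.NumberTheory.Padics.ProperSpace
import Mathlib.LinearAlgebra.Pi
import Mathlib.RingTheory.Noetherian.Basic
import Mathlib.RingTheory.PrincipalIdealDomain
import Mathlib.Topology.Algebra.Module.Basic
import Mathlib.Analysis.SpecificLimits.Basic
import HarnessLib

/-!
# Tate's compactness argument on `ℤ_p²`

The limit step of Tate, Invent. Math. 2 (1966), §2, proof of Proposition 1 (p. 137: "Since
`End(X_n)` is compact we can extract from `(u_i)` a subsequence which converges to a limit `u`, and
this limit is in `E_ℓ` because `E_ℓ` is closed ... `u(X_n) = ⋂ X_j = T ∩ W`"), isolated as a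
statement about the free module `ℤ_p²` (`Fin 2 → ℤ_[p]`) with a purely algebraic interface, for
use in the elliptic-curve case of Tate's theorem
(`Literature.AlgebraicGeometry.Motives.FaltingsEC`,
`Literature.AlgebraicGeometry.Motives.mem_span_range_tateModule_map_of_equivariant_of_finite`):

* `Literature.AlgebraicGeometry.Motives.FinTwo.exists_ne_zero_forall_mem_span_of_approx`: let `N` be a `ℤ_p`-submodule of
  `End(ℤ_p²)`, `v ∈ ℤ_p²` and `c ≠ 0`. If for every `k` some `u_k ∈ N` maps `ℤ_p²` into
  `ℤ_p v + p ^ k ℤ_p²` and takes the value `c` somewhere, then some non-zero `u ∈ N` maps `ℤ_p²`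
  into `ℤ_p v`.

The proof is Tate's: `End(ℤ_p²) ≅ ℤ_p² × ℤ_p²` (values on the standard basis) is compact and
metrisable, so a subsequence of `(u_k, x_k)` (`u_k x_k = c`) converges to `(u, x)`; `u ∈ N` because
a submodule of `ℤ_p⁴` is finitely generated, hence compact, hence closed; `u x = c ≠ 0`; and
`u y ∈ ⋂_k (ℤ_p v + p ^ k ℤ_p²) = ℤ_p v`.

## References

* [Tate1966Endomorphisms] J. Tate, *Endomorphisms of abelian varieties over finite fields*,
  Invent. Math. 2 (1966), 134–144, §2, proof of Proposition 1.
-/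

noncomputable section

open Filter Topology

namespace Literature.AlgebraicGeometry.Motives.FinTwo

variable {p : ℕ} [Fact p.Prime]

/-- An endomorphism of `R²` is determined by its values on `e₀, e₁`:
`u x = x 0 • u e₀ + x 1 • u e₁`. [folklore] -/
theorem apply_eq_smul_add_smul {R : Type*} [CommRing R] {N : Type*} [AddCommGroup N] [Module R N]
    (u : (Fin 2 → R) →ₗ[R] N) (x : Fin 2 → R) :
    u x = x 0 • u (Pi.single 0 1) + x 1 • u (Pi.single 1 1) := by
  conv_lhs => rw [show x = x 0 • (Pi.single 0 1 : Fin 2 → R) + x 1 • Pi.single 1 1 by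
    ext i; fin_cases i <;> simp]
  rw [map_add, map_smul, map_smul]

/-- `p ^ k • z_k → 0` in `ℤ_p²` for any sequence `z_k`. [folklore] -/
theorem tendsto_pow_smul (z : ℕ → Fin 2 → ℤ_[p]) :
    Tendsto (fun k ↦ (p : ℤ_[p]) ^ k • z k) atTop (𝓝 0) := by
  rw [tendsto_pi_nhds]
  intro i
  simp only [Pi.smul_apply, smul_eq_mul, Pi.zero_apply]
  refine squeeze_zero_norm (a := fun k ↦ ((p : ℝ)⁻¹) ^ k) (fun k ↦ ?_) ?_
  · rw [norm_mul, norm_pow, PadicInt.norm_p]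
    exact mul_le_of_le_one_right (pow_nonneg (inv_nonneg.mpr (Nat.cast_nonneg _)) _)
      (PadicInt.norm_le_one _)
  · refine tendsto_pow_atTop_nhds_zero_of_lt_one (inv_nonneg.mpr (Nat.cast_nonneg _)) ?_
    exact inv_lt_one_of_one_lt₀ (by exact_mod_cast (Fact.out : p.Prime).one_lt)

/-- The line `ℤ_p ∙ v ⊆ ℤ_p²` is closed (a continuous image of the compact `ℤ_p`). [folklore] -/
theorem isClosed_span_singleton (v : Fin 2 → ℤ_[p]) :
    IsClosed ((ℤ_[p] ∙ v : Submodule ℤ_[p] (Fin 2 → ℤ_[p])) : Set (Fin 2 → ℤ_[p])) := by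
  have : ((ℤ_[p] ∙ v : Submodule ℤ_[p] (Fin 2 → ℤ_[p])) : Set (Fin 2 → ℤ_[p])) =
      Set.range fun a : ℤ_[p] ↦ a • v := by
    ext y
    simp [Submodule.mem_span_singleton, eq_comm]
  rw [this]
  exact (isCompact_range (continuous_id.smul continuous_const)).isClosed

/-- `⋂_k (ℤ_p v + p ^ k ℤ_p²) = ℤ_p v`: an element lying in `ℤ_p v + p ^ k ℤ_p²` for every `k` lies
on the (closed) line `ℤ_p ∙ v`. [folklore] -/
theorem mem_span_singleton_of_forall_approx {v y : Fin 2 → ℤ_[p]}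
    (h : ∀ k : ℕ, ∃ (a : ℤ_[p]) (z : Fin 2 → ℤ_[p]), y = a • v + (p : ℤ_[p]) ^ k • z) :
    y ∈ (ℤ_[p] ∙ v : Submodule ℤ_[p] (Fin 2 → ℤ_[p])) := by
  choose a z hy using h
  have hlim : Tendsto (fun k ↦ a k • v) atTop (𝓝 y) := by
    have h1 : (fun k ↦ a k • v) = fun k ↦ y - (p : ℤ_[p]) ^ k • z k := by
      funext k
      rw [hy k, add_sub_cancel_right]
    have h2 : Tendsto (fun k ↦ y - (p : ℤ_[p]) ^ k • z k) atTop (𝓝 (y - 0)) :=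
      tendsto_const_nhds.sub (tendsto_pow_smul z)
    rwa [sub_zero, ← h1] at h2
  exact (isClosed_span_singleton v).mem_of_tendsto hlim
    (Eventually.of_forall fun k ↦ Submodule.mem_span_singleton.mpr ⟨a k, rfl⟩)

/-- The set `ℤ_p v + p ^ k ℤ_p²` is closed (a continuous image of the compact `ℤ_p × ℤ_p²`).
[folklore] -/
theorem isClosed_approx (v : Fin 2 → ℤ_[p]) (k : ℕ) :
    IsClosed {y : Fin 2 → ℤ_[p] | ∃ (a : ℤ_[p]) (z : Fin 2 → ℤ_[p]), y = a • v + (p : ℤ_[p]) ^ k • z} := by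
  have : {y : Fin 2 → ℤ_[p] | ∃ (a : ℤ_[p]) (z : Fin 2 → ℤ_[p]), y = a • v + (p : ℤ_[p]) ^ k • z} =
      Set.range fun az : ℤ_[p] × (Fin 2 → ℤ_[p]) ↦ az.1 • v + (p : ℤ_[p]) ^ k • az.2 := by
    ext y
    simp only [Set.mem_setOf_eq, Set.mem_range, Prod.exists]
    constructor
    · rintro ⟨a, z, rfl⟩; exact ⟨a, z, rfl⟩
    · rintro ⟨a, z, rfl⟩; exact ⟨a, z, rfl⟩
  rw [this]
  refine (isCompact_range (?_ : Continuous fun az : ℤ_[p] × (Fin 2 → ℤ_[p]) ↦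
    az.1 • v + (p : ℤ_[p]) ^ k • az.2)).isClosed
  exact (continuous_fst.smul continuous_const).add
    ((continuous_snd.const_smul ((p : ℤ_[p]) ^ k) :
      Continuous fun az : ℤ_[p] × (Fin 2 → ℤ_[p]) ↦ (p : ℤ_[p]) ^ k • az.2))

/-- A `ℤ_p`-submodule of `ℤ_p² × ℤ_p²` is closed: it is finitely generated (`ℤ_p` is Noetherian),
hence the continuous image of a compact `ℤ_p ^ r`. (Tate: "`E_ℓ` is closed".) [folklore] -/
theorem isClosed_submodule (N : Submodule ℤ_[p] ((Fin 2 → ℤ_[p]) × (Fin 2 → ℤ_[p]))) :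
    IsClosed (N : Set ((Fin 2 → ℤ_[p]) × (Fin 2 → ℤ_[p]))) := by
  have hfg : N.FG := IsNoetherian.noetherian N
  obtain ⟨s, hs⟩ := hfg
  have h1 : Set.range (fun i : s ↦ (i : (Fin 2 → ℤ_[p]) × (Fin 2 → ℤ_[p]))) = (s : Set _) := by
    ext y
    simp
  have hN : (N : Set ((Fin 2 → ℤ_[p]) × (Fin 2 → ℤ_[p]))) =
      Set.range (Fintype.linearCombination ℤ_[p]
        (fun i : s ↦ (i : (Fin 2 → ℤ_[p]) × (Fin 2 → ℤ_[p])))) := by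
    rw [← LinearMap.coe_range, Fintype.range_linearCombination, h1, hs]
  rw [hN]
  refine (isCompact_range (?_ : Continuous fun c : s → ℤ_[p] ↦
    Fintype.linearCombination ℤ_[p] (fun i : s ↦ (i : (Fin 2 → ℤ_[p]) × (Fin 2 → ℤ_[p]))) c)).isClosed
  simp only [Fintype.linearCombination_apply]
  exact continuous_finsetSum _ fun i _ ↦ (continuous_apply i).smul continuous_const

/-- **Tate's compactness argument** (Tate, Invent. Math. 2 (1966), §2, proof of Proposition 1),
on `ℤ_p²`. Let `N` be a `ℤ_p`-submodule of `End(ℤ_p²)`, `v ∈ ℤ_p²`, and `c ∈ ℤ_p²` non-zero.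
Suppose that for every `k` there are `u_k ∈ N` and `x_k` with `u_k x_k = c` and
`u_k(ℤ_p²) ⊆ ℤ_p v + p ^ k ℤ_p²`. Then there is a non-zero `u ∈ N` with `u(ℤ_p²) ⊆ ℤ_p ∙ v`:
a limit of a subsequence of `(u_k)` (compactness of `End(ℤ_p²)`, closedness of `N`), non-zero at a
limit point of `(x_k)`. [cite: Tate1966Endomorphisms, §2 Proposition 1 (proof)] -/
theorem exists_ne_zero_forall_mem_span_of_approx
    (N : Submodule ℤ_[p] (Module.End ℤ_[p] (Fin 2 → ℤ_[p]))) (v : Fin 2 → ℤ_[p])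
    {c : Fin 2 → ℤ_[p]} (hc : c ≠ 0)
    (h : ∀ k : ℕ, ∃ u ∈ N, (∃ xk : Fin 2 → ℤ_[p], u xk = c) ∧
      ∀ x, ∃ (a : ℤ_[p]) (z : Fin 2 → ℤ_[p]), u x = a • v + (p : ℤ_[p]) ^ k • z) :
    ∃ u ∈ N, u ≠ 0 ∧ ∀ x, u x ∈ (ℤ_[p] ∙ v : Submodule ℤ_[p] (Fin 2 → ℤ_[p])) := by
  choose u huN hux happ using h
  choose xk hxk using hux
  -- values on the standard basis, and the points `x_k`
  set e₀ : Fin 2 → ℤ_[p] := Pi.single 0 1 with he₀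
  set e₁ : Fin 2 → ℤ_[p] := Pi.single 1 1 with he₁
  set s : ℕ → ((Fin 2 → ℤ_[p]) × (Fin 2 → ℤ_[p])) × (Fin 2 → ℤ_[p]) :=
    fun k ↦ ((u k e₀, u k e₁), xk k) with hs
  obtain ⟨⟨⟨w₀, w₁⟩, x⟩, φ, hφ, hlim⟩ := CompactSpace.tendsto_subseq s
  have hφk : ∀ k, k ≤ φ k := hφ.id_le
  -- the limit endomorphism
  set ulim : Module.End ℤ_[p] (Fin 2 → ℤ_[p]) :=
    (LinearMap.proj 0 : (Fin 2 → ℤ_[p]) →ₗ[ℤ_[p]] ℤ_[p]).smulRight w₀ +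
      (LinearMap.proj 1 : (Fin 2 → ℤ_[p]) →ₗ[ℤ_[p]] ℤ_[p]).smulRight w₁ with hulim
  have hulim_apply : ∀ y, ulim y = y 0 • w₀ + y 1 • w₁ := fun y ↦ by
    simp [hulim, LinearMap.smulRight_apply]
  -- componentwise limits
  have hlim₀ : Tendsto (fun k ↦ u (φ k) e₀) atTop (𝓝 w₀) :=
    (continuous_fst.tendsto _).comp ((continuous_fst.tendsto _).comp hlim)
  have hlim₁ : Tendsto (fun k ↦ u (φ k) e₁) atTop (𝓝 w₁) :=
    (continuous_snd.tendsto _).comp ((continuous_fst.tendsto _).comp hlim)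
  have hlimx : Tendsto (fun k ↦ xk (φ k)) atTop (𝓝 x) := (continuous_snd.tendsto _).comp hlim
  -- pointwise convergence `u (φ k) y → ulim y`
  have hpt : ∀ y, Tendsto (fun k ↦ u (φ k) y) atTop (𝓝 (ulim y)) := fun y ↦ by
    have : (fun k ↦ u (φ k) y) = fun k ↦ y 0 • u (φ k) e₀ + y 1 • u (φ k) e₁ :=
      funext fun k ↦ apply_eq_smul_add_smul _ _
    rw [this, hulim_apply]
    exact (hlim₀.const_smul _).add (hlim₁.const_smul _)
  -- `ulim x = c`
  have hulimx : ulim x = c := by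
    have h1 : Tendsto (fun k ↦ u (φ k) (xk (φ k))) atTop (𝓝 (ulim x)) := by
      have : (fun k ↦ u (φ k) (xk (φ k))) =
          fun k ↦ xk (φ k) 0 • u (φ k) e₀ + xk (φ k) 1 • u (φ k) e₁ :=
        funext fun k ↦ apply_eq_smul_add_smul _ _
      rw [this, hulim_apply]
      exact (((continuous_apply 0).tendsto _).comp hlimx |>.smul hlim₀).add
        (((continuous_apply 1).tendsto _).comp hlimx |>.smul hlim₁)
    have h2 : Tendsto (fun k ↦ u (φ k) (xk (φ k))) atTop (𝓝 c) := by
      simp only [hxk]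
      exact tendsto_const_nhds
    exact tendsto_nhds_unique h1 h2
  refine ⟨ulim, ?_, ?_, fun y ↦ ?_⟩
  · -- `ulim ∈ N`: `N` is closed in `End ≅ ℤ_p² × ℤ_p²`
    set Φ : Module.End ℤ_[p] (Fin 2 → ℤ_[p]) →ₗ[ℤ_[p]] (Fin 2 → ℤ_[p]) × (Fin 2 → ℤ_[p]) :=
      (LinearMap.applyₗ e₀).prod (LinearMap.applyₗ e₁) with hΦ
    have hΦ_apply : ∀ w, Φ w = (w e₀, w e₁) := fun w ↦ rfl
    have hmem : (w₀, w₁) ∈ N.map Φ := by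
      refine (isClosed_submodule (N.map Φ)).mem_of_tendsto
        ((continuous_fst.tendsto _).comp hlim) (Eventually.of_forall fun k ↦ ?_)
      exact ⟨u (φ k), huN _, rfl⟩
    obtain ⟨w, hwN, hw⟩ := hmem
    have : w = ulim := by
      refine LinearMap.ext fun y ↦ ?_
      rw [apply_eq_smul_add_smul w y, hulim_apply]
      rw [hΦ_apply, Prod.mk.injEq] at hw
      rw [hw.1, hw.2]
    exact this ▸ hwN
  · intro h0
    rw [h0, LinearMap.zero_apply] at hulimx
    exact hc hulimx.symm
  · refine mem_span_singleton_of_forall_approx fun k ↦ ?_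
    have hmem : ulim y ∈ {y' : Fin 2 → ℤ_[p] |
        ∃ (a : ℤ_[p]) (z : Fin 2 → ℤ_[p]), y' = a • v + (p : ℤ_[p]) ^ k • z} := by
      refine (isClosed_approx v k).mem_of_tendsto (hpt y) ?_
      refine eventually_atTop.mpr ⟨k, fun j hj ↦ ?_⟩
      obtain ⟨a, z, haz⟩ := happ (φ j) y
      refine ⟨a, (p : ℤ_[p]) ^ (φ j - k) • z, ?_⟩
      rw [haz, smul_smul, ← pow_add, Nat.add_sub_cancel' ((hj.trans (hφk j)))]
    exact hmem

end Literature.AlgebraicGeometry.Motives.FinTwo
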